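import Summits.KontsevichZagierPeriods.KontsevichZagierPeriods.Theorems.LinRedNormalFormArrangementNormalFormStubRebaseSimpleZeroNestedDiffE1VertexWedge

/-!
# Stub `stub_rebaseSimpleZeroTwo`, part `rebaseSimpleZero_HDiff1_of_HPar1` (crux
`ArrangementNormalForm`, line `janus-bands`) — brick `NestedDiffE1VertexInner`

**A pinch vertex carrying the INNER letter.** A datum of the interval normal form `HDiff₁`
(`RebaseE1.IsDN`: clean nest `A(y) < tᵢ < tⱼ < B(y)` over `{l < y < u}`, inner letter `cᵢ`
constant, outer letter `cⱼ` of slope `λ ≠ 0`, base constant `K ≠ 0`) which pinches at the left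
end, `A(l) = B(l) = t₀`, whose inner letter passes through the vertex (`cᵢ = t₀`) while the outer
letter and the base pole stay off it (`cⱼ(l) ≠ t₀`, pole off `[l, u]`), and whose right end is
regular, is good for `GG 0 2 2` given `HPar1` (`IsDN.good_vtx_inner`, registered as
`rebaseSimpleZero_E1vertexInner`). By the side of the inner letter (`IsDN.inner_side`) the band
opens upwards (`A' ≥ 0`; `A' = 0` is `HPar1`) or downwards (`B' ≤ 0`); after the base cut at an
explicit mesh `l + δ` (right piece regular, `IsDN.good_middle`), with `η = |cⱼ(l) − t₀|`:
* `A' > 0` (`IsDN.good_vtx_inner_up`): super-section Janus at `cⱼ`-parallel height `t₀ + η/2`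
  (`IsDN.good_sup`); `tᵢ − t₀ > A'(y − l)` gives `√((tᵢ − t₀)(y − l)) ≤ (tᵢ − t₀)/√A'`, the wedge
  estimate in the frame `(tⱼ, tᵢ, y)`;
* `B' ≤ 0` (`IsDN.good_vtx_inner_down`): sub-section Janus at the constant `t₀ − η/4`
  (`IsDN.good_sub`); `t₀ − tᵢ > t₀ − tⱼ > 0` gives `√((t₀ − tᵢ)(t₀ − tⱼ)) ≤ t₀ − tᵢ`, the wedge
  estimate in the frame `(y, tᵢ, tⱼ)`.

References: M. Kontsevich, D. Zagier, *Periods* (2001), §1.2, rules (1a), (2).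
-/

noncomputable section

open Set MeasureTheory MvPolynomial
open Literature.NumberTheory.Transcendental Literature.ModelTheory.ExponentialFields

namespace Summit.KontsevichZagierPeriods.ArrangementNormalForm.JanusBands

namespace RebaseE1

open SeparatePos RebasePos RebaseZero RebaseNest RebaseDiff

variable {i j : Fin 2} {s : KZ.IntegralRep (0 + 1 + 2)} {l u : ℚ} {A B : Cf} {T : BData}
  {p : MvPolynomial (Fin 0) ℚ} {a : Fin 2 → Option Cf} {ci cj : Cf}

/-! ### The band opens upwards -/

/-- **Inner letter through the vertex, `A' > 0`.** Super-section Janus at the `cⱼ`-parallel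
section through `(l, t₀ + η/2)` after the base cut; the box converges by the wedge estimate in
the frame `(tⱼ, tᵢ, y)`. [Kontsevich–Zagier 2001, §1.2, rules (1a), (2)] -/
theorem IsDN.good_vtx_inner_up (h : IsDN s l u A B T p a i j) (hL : LData T a i j ci cj)
    (hP : HParS T p a i j ci cj) (hK : Kc T p ≠ 0) (hpinch : evq A l = evq B l)
    (hci : ci.2 = evq A l) (hcj : evq cj l ≠ evq A l) (hαpos : 0 < A.1 (Fin.last 0))
    (hreg : evq A u < evq B u) (hr : T.ℓ₂.2 < l ∨ u < T.ℓ₂.2) : Good 2 (KZ.of s) := by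
  have hij := h.ne
  have hadm : T.n₁ = 0 ∨ T.n₂ = 0 := Or.inl hL.n1
  -- constants
  set t₀ : ℚ := evq A l with ht₀
  set α : ℚ := A.1 (Fin.last 0) with hα
  set β : ℚ := B.1 (Fin.last 0) with hβ
  set lam : ℚ := cj.1 (Fin.last 0) with hlamdef
  set η : ℚ := |evq cj l - t₀| with hη
  have hη0 : 0 < η := abs_pos.2 (sub_ne_zero.2 hcj)
  obtain ⟨δ, hδ0, hqu, hαδ, hβδ, hlamδ⟩ := exists_mesh h.lu α β lam hη0
  have hlq : l < l + δ := by linarith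
  -- cut at `l + δ`; the right piece is regular
  refine h.good_split (l + δ) hlq hqu (fun s₁ h₁ => ?_) fun s₂ h₂ =>
    h₂.good_middle hL hP hK (h.evq_lt hlq hqu) hreg (hr.imp_left fun hr' => hr'.trans hlq)
  -- real bookkeeping
  have hη0R : (0 : ℝ) < η := by exact_mod_cast hη0
  have hηR : (η : ℝ) = |(evq cj l : ℝ) - t₀| := by rw [hη, Rat.cast_abs, Rat.cast_sub]
  have hαδR : |(α : ℝ)| * δ ≤ η / 8 := by rw [← Rat.cast_abs]; exact_mod_cast hαδ
  have hβδR : |(β : ℝ)| * δ ≤ η / 8 := by rw [← Rat.cast_abs]; exact_mod_cast hβδ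
  have hlamδR : |(lam : ℝ)| * δ ≤ η / 8 := by rw [← Rat.cast_abs]; exact_mod_cast hlamδ
  have hαR : (0 : ℝ) < α := by exact_mod_cast hαpos
  have hA : ∀ y : ℝ, ev A y = t₀ + α * (y - l) := fun y => by rw [ev_pinch A l]
  have hB : ∀ y : ℝ, ev B y = t₀ + β * (y - l) := fun y => by rw [ev_pinch B l, ← hpinch]
  have hC : ∀ y : ℝ, ev cj y = evq cj l + lam * (y - l) := fun y => by rw [ev_pinch cj l]
  have hciv : ∀ y : ℝ, ev ci y = t₀ := fun y => by rw [ev_of_fst_eq_zero hL.ci0, hci]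
  -- the section
  set Z : Cf := RebaseZero.mk lam (t₀ - lam * l + η / 2) with hZ
  have hZv : ∀ y : ℝ, ev Z y = t₀ + η / 2 + lam * (y - l) := fun y => by rw [hZ, ev_mk]; push_cast; ring
  have hBZ : ∀ y : ℝ, (l : ℝ) < y → y < ((l + δ : ℚ) : ℝ) → ev B y < ev Z y := fun y h1 h2 => by
    push_cast at h2
    rw [hZv, hB]
    have := (abs_le.1 (abs_slope_mul_le hβδR h1 h2)).2
    have := (abs_le.1 (abs_slope_mul_le hlamδR h1 h2)).1
    linarith
  -- pole margin
  obtain ⟨ρ, hρ, hρle⟩ := pole_margin hr hqu.le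
  -- the box converges
  have hWW : IntegrableOn (glitB T p a)
      (gDom 0 2 2 ![RebaseZero.mk 1 (-l), RebaseZero.mk (-1) (l + δ)] (nlo i A) (nhi j Z)) := by
    refine integrableOn_of_wedge (isSemialgebraic_gDom _ _ _ _) (isBounded_nDom_Ioo hij l (l + δ) _ _)
      (isSemialgebraicFunOn_glit (isSemialgebraic_gDom _ _ _ _) _ _ _ _ _ _ _ _) (wLinY i j (0 : ℝ))
      (wLinY_det_ne hij _) (t₀ : ℝ) (l : ℝ) (|Kc T p| * (1 / Real.sqrt α) / (ρ * (η / 4)))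
      fun z hz hz1 hz2 => ?_
    obtain ⟨-, e1, e2⟩ := wLinY_apply i j (0 : ℝ) z
    rw [e1] at hz1 ⊢
    rw [e2] at hz2 ⊢
    rw [mem_nDom_Ioo hij] at hz
    obtain ⟨⟨hy1, hy2⟩, h3, h4, h5⟩ := hz
    have hY : ρ ≤ |yv z - T.ℓ₂.2| := hρle _ hy1 hy2
    push_cast at hy2
    rw [hZv] at h5
    rw [hA] at h3
    -- the three factors
    have hαy := abs_le.1 (abs_slope_mul_le hαδR hy1 hy2)
    have hlamy := abs_slope_mul_le hlamδR hy1 hy2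
    have hgj : (η : ℝ) / 4 ≤ |tv z j - ev cj (yv z)| := by
      rw [hC]
      exact outer_margin hηR hlamy (by linarith [hαy.1]) (by linarith [(abs_le.1 hlamy).2])
    have hPpos : 0 < tv z i - t₀ := by nlinarith
    have hL1 : |tv z i - 0 * yv z - t₀| = tv z i - t₀ := by
      rw [zero_mul, sub_zero, abs_of_pos hPpos]
    have hL2 : |yv z - l| = yv z - l := abs_of_pos (by linarith)
    have hsq : Real.sqrt |tv z i - 0 * yv z - t₀| * Real.sqrt |yv z - l| ≤ (1 / Real.sqrt α) * (tv z i - t₀) := by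
      rw [hL1, hL2, mul_comm]
      have key := sqrt_mul_sqrt_le_weighted hαR (by linarith : (0 : ℝ) ≤ yv z - l) hPpos.le
      have hs : 0 < Real.sqrt α := Real.sqrt_pos.2 hαR
      have hlt : (α : ℝ) * (yv z - l) < tv z i - t₀ := by linarith
      calc Real.sqrt (yv z - l) * Real.sqrt (tv z i - t₀) ≤ (α * (yv z - l) + (tv z i - t₀)) / (2 * Real.sqrt α) := key
        _ ≤ (2 * (tv z i - t₀)) / (2 * Real.sqrt α) := by
            rw [div_le_div_iff_of_pos_right (by positivity)]; linarith
        _ = (1 / Real.sqrt α) * (tv z i - t₀) := by field_simp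
    have hgi : 1 / |tv z i - ev ci (yv z)| ≤ (1 / Real.sqrt α) /
        (Real.sqrt |tv z i - 0 * yv z - t₀| * Real.sqrt |yv z - l|) := by
      rw [hciv, abs_of_pos hPpos]
      exact one_div_le_sqrt hPpos (sub_ne_zero.2 hz1) (sub_ne_zero.2 hz2) hsq
    have hS : 0 < Real.sqrt |tv z i - 0 * yv z - t₀| * Real.sqrt |yv z - l| :=
      mul_pos (Real.sqrt_pos.2 (abs_pos.2 (sub_ne_zero.2 hz1))) (Real.sqrt_pos.2 (abs_pos.2 (sub_ne_zero.2 hz2)))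
    rw [abs_glitB hL p z]
    refine wedge_bound hρ (by positivity) hS hY ?_
    calc (1 / |tv z i - ev ci (yv z)|) * (1 / |tv z j - ev cj (yv z)|)
        ≤ ((1 / Real.sqrt α) / (Real.sqrt |tv z i - 0 * yv z - t₀| * Real.sqrt |yv z - l|)) * (1 / (η / 4)) :=
          mul_le_mul hgi (one_div_le_one_div_of_le (by positivity) hgj) (by positivity) (by positivity)
      _ = (1 / (η / 4)) * ((1 / Real.sqrt α) / (Real.sqrt |tv z i - 0 * yv z - t₀| * Real.sqrt |yv z - l|)) :=
          mul_comm _ _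
  have fT : Z.1 (Fin.last 0) = cj.1 (Fin.last 0) := by rw [hZ, mk_fst]
  exact h₁.good_sup hadm Z hBZ hWW (fun W hW' => hW'.good_par hP (Or.inr fT)) fun r₃ hr₃ =>
    hr₃.good_par hP (Or.inr fT)

/-! ### The band opens downwards -/

/-- **Inner letter through the vertex, `B' ≤ 0`.** Sub-section Janus at the constant `t₀ − η/4`
after the base cut; the box converges by the wedge estimate in the frame `(y, tᵢ, tⱼ)`.
[Kontsevich–Zagier 2001, §1.2, rules (1a), (2)] -/
theorem IsDN.good_vtx_inner_down (h : IsDN s l u A B T p a i j) (hL : LData T a i j ci cj)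
    (hP : HParS T p a i j ci cj) (hK : Kc T p ≠ 0) (hpinch : evq A l = evq B l)
    (hci : ci.2 = evq A l) (hcj : evq cj l ≠ evq A l) (hβle : B.1 (Fin.last 0) ≤ 0)
    (hreg : evq A u < evq B u) (hr : T.ℓ₂.2 < l ∨ u < T.ℓ₂.2) : Good 2 (KZ.of s) := by
  have hij := h.ne
  have hadm : T.n₁ = 0 ∨ T.n₂ = 0 := Or.inl hL.n1
  -- constants
  set t₀ : ℚ := evq A l with ht₀
  set α : ℚ := A.1 (Fin.last 0) with hα
  set β : ℚ := B.1 (Fin.last 0) with hβ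
  set lam : ℚ := cj.1 (Fin.last 0) with hlamdef
  set η : ℚ := |evq cj l - t₀| with hη
  have hη0 : 0 < η := abs_pos.2 (sub_ne_zero.2 hcj)
  obtain ⟨δ, hδ0, hqu, hαδ, -, hlamδ⟩ := exists_mesh h.lu α β lam hη0
  have hlq : l < l + δ := by linarith
  -- cut at `l + δ`; the right piece is regular
  refine h.good_split (l + δ) hlq hqu (fun s₁ h₁ => ?_) fun s₂ h₂ =>
    h₂.good_middle hL hP hK (h.evq_lt hlq hqu) hreg (hr.imp_left fun hr' => hr'.trans hlq)
  -- real bookkeeping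
  have hη0R : (0 : ℝ) < η := by exact_mod_cast hη0
  have hηR : (η : ℝ) = |(evq cj l : ℝ) - t₀| := by rw [hη, Rat.cast_abs, Rat.cast_sub]
  have hαδR : |(α : ℝ)| * δ ≤ η / 8 := by rw [← Rat.cast_abs]; exact_mod_cast hαδ
  have hlamδR : |(lam : ℝ)| * δ ≤ η / 8 := by rw [← Rat.cast_abs]; exact_mod_cast hlamδ
  have hβR : (β : ℝ) ≤ 0 := by exact_mod_cast hβle
  have hA : ∀ y : ℝ, ev A y = t₀ + α * (y - l) := fun y => by rw [ev_pinch A l]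
  have hB : ∀ y : ℝ, ev B y = t₀ + β * (y - l) := fun y => by rw [ev_pinch B l, ← hpinch]
  have hC : ∀ y : ℝ, ev cj y = evq cj l + lam * (y - l) := fun y => by rw [ev_pinch cj l]
  have hciv : ∀ y : ℝ, ev ci y = t₀ := fun y => by rw [ev_of_fst_eq_zero hL.ci0, hci]
  -- the section
  set X : Cf := RebaseZero.mk 0 (t₀ - η / 4) with hX
  have hXv : ∀ y : ℝ, ev X y = t₀ - η / 4 := fun y => by rw [hX, ev_mk_zero]; push_cast; ring
  have hXA : ∀ y : ℝ, (l : ℝ) < y → y < ((l + δ : ℚ) : ℝ) → ev X y < ev A y := fun y h1 h2 => by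
    push_cast at h2
    rw [hXv, hA]
    have := (abs_le.1 (abs_slope_mul_le hαδR h1 h2)).1
    linarith
  -- pole margin
  obtain ⟨ρ, hρ, hρle⟩ := pole_margin hr hqu.le
  -- the box converges
  have hWW : IntegrableOn (glitB T p a)
      (gDom 0 2 2 ![RebaseZero.mk 1 (-l), RebaseZero.mk (-1) (l + δ)] (nlo i X) (nhi j B)) := by
    refine integrableOn_of_wedge (isSemialgebraic_gDom _ _ _ _) (isBounded_nDom_Ioo hij l (l + δ) _ _)
      (isSemialgebraicFunOn_glit (isSemialgebraic_gDom _ _ _ _) _ _ _ _ _ _ _ _) (wLinT i j (0 : ℝ))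
      (wLinT_det_ne hij _) (t₀ : ℝ) (t₀ : ℝ) (|Kc T p| * 1 / (ρ * (η / 4)))
      fun z hz hz1 hz2 => ?_
    obtain ⟨-, e1, e2⟩ := wLinT_apply i j (0 : ℝ) z
    rw [e1] at hz1 ⊢
    rw [e2] at hz2 ⊢
    rw [mem_nDom_Ioo hij] at hz
    obtain ⟨⟨hy1, hy2⟩, h3, h4, h5⟩ := hz
    have hY : ρ ≤ |yv z - T.ℓ₂.2| := hρle _ hy1 hy2
    push_cast at hy2
    rw [hXv] at h3
    rw [hB] at h5
    -- the three factors
    have hlamy := abs_slope_mul_le hlamδR hy1 hy2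
    have hβy : (β : ℝ) * (yv z - l) ≤ 0 := mul_nonpos_of_nonpos_of_nonneg hβR (by linarith)
    have hgj : (η : ℝ) / 4 ≤ |tv z j - ev cj (yv z)| := by
      rw [hC]
      exact outer_margin hηR hlamy (by linarith) (by linarith)
    have hPneg : tv z i - t₀ < 0 := by linarith
    have hQneg : tv z j - t₀ < 0 := by linarith
    have hL1 : |tv z i - 0 * yv z - t₀| = t₀ - tv z i := by
      rw [zero_mul, sub_zero, abs_of_neg hPneg]; ring
    have hL2 : |tv z j - 0 * yv z - t₀| = t₀ - tv z j := by
      rw [zero_mul, sub_zero, abs_of_neg hQneg]; ring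
    have hsq : Real.sqrt |tv z i - 0 * yv z - t₀| * Real.sqrt |tv z j - 0 * yv z - t₀| ≤ 1 * (t₀ - tv z i) := by
      rw [hL1, hL2, mul_comm, one_mul]
      exact sqrt_mul_sqrt_le_of_le (by linarith) (by linarith)
    have hgi : 1 / |tv z i - ev ci (yv z)| ≤ 1 /
        (Real.sqrt |tv z i - 0 * yv z - t₀| * Real.sqrt |tv z j - 0 * yv z - t₀|) := by
      rw [hciv, abs_of_neg hPneg, neg_sub]
      exact one_div_le_sqrt (by linarith) (sub_ne_zero.2 hz1) (sub_ne_zero.2 hz2) hsq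
    have hS : 0 < Real.sqrt |tv z i - 0 * yv z - t₀| * Real.sqrt |tv z j - 0 * yv z - t₀| :=
      mul_pos (Real.sqrt_pos.2 (abs_pos.2 (sub_ne_zero.2 hz1))) (Real.sqrt_pos.2 (abs_pos.2 (sub_ne_zero.2 hz2)))
    rw [abs_glitB hL p z]
    refine wedge_bound hρ (by positivity) hS hY ?_
    calc (1 / |tv z i - ev ci (yv z)|) * (1 / |tv z j - ev cj (yv z)|)
        ≤ (1 / (Real.sqrt |tv z i - 0 * yv z - t₀| * Real.sqrt |tv z j - 0 * yv z - t₀|)) * (1 / (η / 4)) :=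
          mul_le_mul hgi (one_div_le_one_div_of_le (by positivity) hgj) (by positivity) (by positivity)
      _ = (1 / (η / 4)) * (1 / (Real.sqrt |tv z i - 0 * yv z - t₀| * Real.sqrt |tv z j - 0 * yv z - t₀|)) :=
          mul_comm _ _
  have fT : X.1 (Fin.last 0) = ci.1 (Fin.last 0) := by rw [hX, mk_fst, hL.ci0]
  exact h₁.good_sub hadm X hXA hWW (fun W hW' => hW'.good_par hP (Or.inl fT)) fun r₁ hr₁ =>
    hr₁.good_par hP (Or.inl fT)

/-! ### The driver -/

/-- **A pinch vertex carrying the inner letter only** (pole and outer letter off the vertex,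
regular right end) is good given `HPar1`: by the side of the inner letter (`IsDN.inner_side`),
the band opens upwards, `A' ≥ 0` (`A' = 0` is `HPar1`, else `good_vtx_inner_up`), or downwards,
`B' ≤ 0` (`good_vtx_inner_down`). [Kontsevich–Zagier 2001, §1.2] -/
theorem IsDN.good_vtx_inner (h : IsDN s l u A B T p a i j) (hL : LData T a i j ci cj)
    (hP : HParS T p a i j ci cj) (hK : Kc T p ≠ 0) (hpinch : evq A l = evq B l)
    (hci : ci.2 = evq A l) (hcj : evq cj l ≠ evq A l) (hreg : evq A u < evq B u)
    (hr : T.ℓ₂.2 < l ∨ u < T.ℓ₂.2) : Good 2 (KZ.of s) := by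
  have hlu : (l : ℝ) < u := by exact_mod_cast h.lu
  have hm1 : (l : ℝ) < ((l : ℝ) + u) / 2 := by linarith
  have hm2 : ((l : ℝ) + u) / 2 < u := by linarith
  rcases lt_trichotomy (A.1 (Fin.last 0)) 0 with hneg | hzero | hpos
  · rcases h.inner_side hL hK with hlo | hhi
    · exfalso
      have key := hlo _ hm1 hm2
      rw [ev_of_fst_eq_zero hL.ci0, hci, ev_pinch A l] at key
      have hneg' : (A.1 (Fin.last 0) : ℝ) < 0 := by exact_mod_cast hneg
      nlinarith
    · have key := hhi _ hm1 hm2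
      rw [ev_of_fst_eq_zero hL.ci0, hci, ev_pinch B l, ← hpinch] at key
      have hle : (B.1 (Fin.last 0) : ℝ) ≤ 0 := by nlinarith
      exact h.good_vtx_inner_down hL hP hK hpinch hci hcj (by exact_mod_cast hle) hreg hr
  · exact h.good_par hP (Or.inl (hzero.trans hL.ci0.symm))
  · exact h.good_vtx_inner_up hL hP hK hpinch hci hcj hpos hreg hr

end RebaseE1

/-- **Registered brick `rebaseSimpleZero_E1vertexInner`** (part `rebaseSimpleZero_HDiff1_of_HPar1` of
`stub_rebaseSimpleZeroTwo`, line `janus-bands`): a datum of the interval normal form `HDiff₁`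
(`RebaseE1.IsDN`) with non-zero base constant which pinches at the left end, whose INNER letter
passes through the pinch vertex while the outer letter and the base pole stay off it, and whose
right end is regular, is congruent modulo `KZ.relations` to the subgroup generated by `GG 0 2 2`,
given `HPar1` (`RebaseE1.IsDN.good_vtx_inner`: base cut at an explicit mesh, then one super- or
sub-section Janus whose box converges by the wedge estimate). [Kontsevich–Zagier 2001, §1.2] -/
theorem rebaseSimpleZero_E1vertexInner (i j : Fin 2) (s : KZ.IntegralRep (0 + 1 + 2)) (l u : ℚ) (A B ci cj : (Fin (0 + 1) → ℚ) × ℚ) (T : RebaseZero.BData) (p : MvPolynomial (Fin 0) ℚ) (a : Fin 2 → Option ((Fin (0 + 1) → ℚ) × ℚ)) (h : RebaseE1.IsDN s l u A B T p a i j) (hL : RebaseE1.LData T a i j ci cj) (hP : RebaseE1.HParS T p a i j ci cj) (hK : RebaseDiff.Kc T p ≠ 0) (hpinch : RebaseE1.evq A l = RebaseE1.evq B l) (hci : ci.2 = RebaseE1.evq A l) (hcj : RebaseE1.evq cj l ≠ RebaseE1.evq A l) (hreg : RebaseE1.evq A u < RebaseE1.evq B u) (hr : T.ℓ₂.2 <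 l ∨ u < T.ℓ₂.2) : RebaseZero.Good 2 (KZ.of s) :=
  h.good_vtx_inner hL hP hK hpinch hci hcj hreg hr

end Summit.KontsevichZagierPeriods.ArrangementNormalForm.JanusBands
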